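import Summits.ABC.StewartYu.PadicG3OneAssembly
import Summits.ABC.StewartYu.PadicG3OneLines
import Summits.ABC.StewartYu.PadicG3OneHalfLine
import HarnessLib

/-!
# Crux `Y07Odd` (stmt-ABC-19658), line `gen3-slab-odd`: the registered stub `stub_ineqs1` (branch `m ≥ 1`) AS A THEOREM

`Summits/ABC/ABC/Theorems/PadicPrimesKummerThirdY07OddStubIneqs1.lean` — cell `abc-stewartyu` (HOME `run/shared/lean/pub/abc-stewartyu/`),
seat p5 (g4).  One theorem, no named fact: **`stub_ineqs1`** (namespace `Summit.ABC.ABC.Cruxes.Y07Odd.SlabOdd`, like the landed `stub_ordLineG`) has LITERALLY the signature of the registered stub `stub_ineqs1` of the crux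
skeleton (lead p2-g4, 2026-08-27T05:52Z): CTX → `1 ≤ P.m` → `∃ b, 1 ≤ b ∧ S.IneqPackR₃ (P.sched1b b)`.  It is p5's assembly
`G3Setup.ineqs1_of_gainLines` (`PadicG3OneAssembly`: (B1) = lp-1's `startCountR₂_sched1b_one`, exponent `E` via p2's `expLine_of_negBound` on
lp-1's `headline_odd1_div_log_lit`, exponent lines `hexp*_sched1b`, families `ineqPackR₃_of_lines`) fed with the four gain lines at `b := 1`:
p1-g8's `hgainK0_sched1b` / `hgainO_sched1b` / `hgainK_sched1b` (`PadicG3OneLines`) and p5's `hgainH_sched1b` (`PadicG3OneHalfLine`, on the sharp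
half-point clearing (S1), route-holder ruling R22).

WHAT THIS IS NOT: the crux closer (p2-g4 plugs this theorem into `Y07Odd_proof`); the `m = 0` branch (`stub_ineqsV`, p3-g7).

References: Yu. V. Nesterenko, LNM 1819 (2003) Prop 4.1, §4.2–§4.3; K. Yu, Acta Math. 211 (2013) §7.
-/

noncomputable section

open Finset

namespace Summit.ABC.ABC.Cruxes.Y07Odd.SlabOdd

/-- **The `m ≥ 1` inequality stub of crux `Y07Odd`** (registered signature of `stub_ineqs1`, line `gen3-slab-odd`).
[cite: Nesterenko2003, Prop 4.1, §4.2–§4.3; shape only] -/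
theorem stub_ineqs1 : ∀ (p : ℕ) [Fact p.Prime], p ≠ 2 → ∀ (S : Summit.ABC.StewartYu.G3Setup p), 2 ≤ S.n →
    ∀ (V : Fin S.n → ℝ) (Vmax W : ℝ),
    (∀ j, padicValRat p (S.α j) = 0) →
    (∀ κ : Fin S.n → ℤ, (∃ γ : ℚ, ∏ j, S.α j ^ κ j = γ ^ 2 ∨ ∏ j, S.α j ^ κ j = -γ ^ 2) → ∀ j, (2 : ℤ) ∣ κ j) →
    (∀ j, Height.logHeight₁ (S.α j) ≤ V j) → (∀ j, 1 ≤ V j) → (∀ j, V j ≤ Vmax) →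
    (∀ j, Real.log (max 3 (|S.b j| : ℝ)) ≤ W) → 1 ≤ W →
    ¬ (padicValRat p (∏ j, S.α j ^ S.b j - 1) : ℝ) * Real.log p ≤
        ((2 : ℝ) ^ 100) ^ S.n * ((p : ℝ) / Real.log p) * (∏ j, V j) * (W + Real.log p + Real.log (2 * Vmax)) →
    ∀ (P : Summit.ABC.StewartYu.PadicG3Par S.n), P.p = p → P.A = V → P.Amax ≤ Vmax → P.Amax ≤ 2 ^ S.n * (∏ j, V j) → P.W = W →
      P.Nq = P.K → P.K₀ = p - 1 → P.θ₀ = 1 / 2 →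
      1 ≤ P.m → ∃ b : ℝ, 1 ≤ b ∧ S.IneqPackR₃ (P.sched1b b) := by
  intro p _ hp2 S hn2 V Vmax W hv hkum hV hV1 hVm hWb hW hU P hPp hPA hAmaxV hAmaxΩ hPW hNq hK₀ hθ hm
  have hV' : ∀ j, Height.logHeight₁ (S.α j) ≤ P.A j := fun j => by rw [hPA]; exact hV j
  have hA1 : ∀ j, 1 ≤ P.A j := fun j => by rw [hPA]; exact hV1 j
  have hWb' : ∀ j, Real.log (max 3 (|S.b j| : ℝ)) ≤ P.W := fun j => by rw [hPW]; exact hWb j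
  exact S.ineqs1_of_gainLines hp2 hn2 V Vmax W hv hkum hV hV1 hVm hWb hW hU P hPp hPA hAmaxV hAmaxΩ hPW hNq hK₀ hθ hm
    (S.hgainK0_sched1b P 1 hPp le_rfl hθ hWb' hV' hA1) (S.hgainH_sched1b P 1 le_rfl hn2 hPp hθ hA1 hV' hWb')
    (S.hgainO_sched1b P 1 hPp le_rfl hθ hWb' hV' hA1) (S.hgainK_sched1b P 1 hPp le_rfl hθ hWb' hV' hA1)

end Summit.ABC.ABC.Cruxes.Y07Odd.SlabOdd

end
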